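import Mathlib.Analysis.SpecialFunctions.Integrability.Basic
import Mathlib.Analysis.SpecialFunctions.Integrals.Basic
import Mathlib.Analysis.SpecialFunctions.Sqrt
import Mathlib.Analysis.SpecialFunctions.ImproperIntegrals
import Mathlib.MeasureTheory.Function.JacobianOneDim
import Mathlib.MeasureTheory.Integral.IntegralEqImproper
import Literature.Probability.RandomPlanarGeometry.RectangleModulus
import HarnessLib

/-!
# Elliptic integrals of the first kind: the incomplete integral and a Legendre-type identity

Real-analysis companion to `RectangleModulus.lean` (which defines the complete elliptic integral
`ellipticK u = ∫₀¹ dt/√((1-t²)(1-u t²))` in the Abramowitz–Stegun *parameter* convention used by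
Bollobás–Riordan (2006), p. 185) and first input of the proof of
`rectangle_crossRatio_eq_elliptic` (`RectangleModulusProofs.lean`):

* `ellIntegrand m t = 1/√((1-t²)(1-m t²))` and the **incomplete** integral
  `ellipticF m x = ∫₀ˣ ellIntegrand m` (`ellipticF m 1 = ellipticK m` by `rfl`); positivity,
  integrability on `[-1, 1]` for `0 ≤ m < 1` (the singularity `(1-t)^{-1/2}` at `t = 1` is
  integrable), `ellipticK m > 0`, oddness, strict monotonicity and continuity of `ellipticF m` on
  `[-1, 1]`.
* `integral_Ioi_eq_ellipticK`: for `0 < k < 1`,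
  `∫₀^∞ dy/√((1+y²)(1+k²y²)) = K(1-k²) = ellipticK (1 - k^2)`, by the substitution
  `t = y/√(1+y²)` (a `C¹` bijection `(0,∞) → (0,1)`, `MeasureTheory.integral_image_eq_integral_abs_deriv_smul`).
  This is the classical evaluation of the height `K′(k) = K(k′)`, `k′² = 1 - k²`, of the
  Schwarz–Christoffel rectangle along the imaginary axis (Whittaker–Watson §22.32; Ahlfors (1979),
  Ch. 6 §2.3), in the form consumed by `RectangleSCSymmetry.lean`.

## References

* B. Bollobás, O. Riordan, *Percolation*, CUP (2006), Ch. 7 §7.1, p. 185.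
* E. T. Whittaker, G. N. Watson, *A Course of Modern Analysis*, 4th ed. (1927), §22.3–22.32.
* L. V. Ahlfors, *Complex Analysis*, 3rd ed. (1979), Ch. 6 §2.3.
-/

open Set Filter MeasureTheory
open scoped Real Interval Topology

noncomputable section

namespace Literature.Probability.RandomPlanarGeometry

/-! ### The integrand and the incomplete integral -/

/-- The elliptic integrand of the first kind in parameter form, `1/√((1 - t²)(1 - m t²))`
(junk value `0` where the radicand is `≤ 0`). [cite: BollobasRiordan2006, Ch. 7 §7.1 p. 185] -/
def ellIntegrand (m t : ℝ) : ℝ := 1 / Real.sqrt ((1 - t ^ 2) * (1 - m * t ^ 2))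

/-- The **incomplete elliptic integral of the first kind** (parameter convention),
`F(m; x) = ∫₀ˣ dt/√((1 - t²)(1 - m t²))`, so that `F(m; 1) = K(m) = ellipticK m`.
Abramowitz–Stegun 17.2.7 with `x = sin φ`. [cite: BollobasRiordan2006, Ch. 7 §7.1 p. 185] -/
def ellipticF (m x : ℝ) : ℝ := ∫ t in (0 : ℝ)..x, ellIntegrand m t

/-- `K(m) = ∫₀¹ ellIntegrand m`. [folklore] -/
theorem ellipticK_eq (m : ℝ) : ellipticK m = ∫ t in (0 : ℝ)..1, ellIntegrand m t := rfl

/-- `F(m; 1) = K(m)`. [folklore] -/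
theorem ellipticF_one (m : ℝ) : ellipticF m 1 = ellipticK m := rfl

/-- `F(m; 0) = 0`. [folklore] -/
theorem ellipticF_zero (m : ℝ) : ellipticF m 0 = 0 := intervalIntegral.integral_same

/-- `1 - t² > 0` for `|t| < 1`. [folklore] -/
theorem one_sub_sq_pos_of_mem_Ioo {t : ℝ} (ht : t ∈ Ioo (-1 : ℝ) 1) : 0 < 1 - t ^ 2 := by
  nlinarith [ht.1, ht.2]

/-- `1 - m t² > 0` for `|t| < 1`, `m < 1`. [folklore] -/
theorem one_sub_mul_sq_pos {m t : ℝ} (hm : m < 1) (ht : t ∈ Ioo (-1 : ℝ) 1) : 0 < 1 - m * t ^ 2 := by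
  have ht2 : t ^ 2 < 1 := by nlinarith [ht.1, ht.2]
  by_cases hm0 : 0 ≤ m
  · nlinarith [mul_le_mul_of_nonneg_left ht2.le hm0]
  · nlinarith [sq_nonneg t, not_le.1 hm0]

/-- The radicand `(1 - t²)(1 - m t²)` is positive for `|t| < 1`, `m < 1`. [folklore] -/
theorem ellIntegrand_radicand_pos {m t : ℝ} (hm : m < 1) (ht : t ∈ Ioo (-1 : ℝ) 1) :
    0 < (1 - t ^ 2) * (1 - m * t ^ 2) :=
  mul_pos (one_sub_sq_pos_of_mem_Ioo ht) (one_sub_mul_sq_pos hm ht)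

/-- The integrand is positive on `(-1, 1)` for `m < 1`. [folklore] -/
theorem ellIntegrand_pos {m t : ℝ} (hm : m < 1) (ht : t ∈ Ioo (-1 : ℝ) 1) : 0 < ellIntegrand m t :=
  one_div_pos.2 (Real.sqrt_pos.2 (ellIntegrand_radicand_pos hm ht))

/-- The integrand is everywhere non-negative. [folklore] -/
theorem ellIntegrand_nonneg (m t : ℝ) : 0 ≤ ellIntegrand m t :=
  one_div_nonneg.2 (Real.sqrt_nonneg _)

/-- The integrand is even in `t`. [folklore] -/
theorem ellIntegrand_neg (m t : ℝ) : ellIntegrand m (-t) = ellIntegrand m t := by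
  simp [ellIntegrand]

/-- The integrand is measurable. [folklore] -/
theorem measurable_ellIntegrand (m : ℝ) : Measurable (ellIntegrand m) := by
  unfold ellIntegrand
  fun_prop

/-- The integrand is continuous on `(-1, 1)` for `m < 1`. [folklore] -/
theorem continuousOn_ellIntegrand {m : ℝ} (hm : m < 1) : ContinuousOn (ellIntegrand m) (Ioo (-1 : ℝ) 1) := by
  refine continuousOn_const.div (by fun_prop) fun t ht => ?_
  exact (Real.sqrt_pos.2 (ellIntegrand_radicand_pos hm ht)).ne'

/-- The integrand as a product of real powers on `(-1, 1)`:
`1/√((1-t²)(1-m t²)) = (1-t²)^{-1/2} (1-m t²)^{-1/2}`. [folklore] -/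
theorem ellIntegrand_eq_rpow {m t : ℝ} (hm : m < 1) (ht : t ∈ Ioo (-1 : ℝ) 1) :
    ellIntegrand m t = (1 - t ^ 2) ^ (-(1 / 2 : ℝ)) * (1 - m * t ^ 2) ^ (-(1 / 2 : ℝ)) := by
  have h1 : 0 < 1 - t ^ 2 := one_sub_sq_pos_of_mem_Ioo ht
  have h2 : 0 < 1 - m * t ^ 2 := one_sub_mul_sq_pos hm ht
  rw [ellIntegrand, Real.sqrt_eq_rpow, one_div, ← Real.rpow_neg (by positivity),
    Real.mul_rpow h1.le h2.le]

/-! ### Integrability on `[-1, 1]` -/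

/-- Domination on `[0, 1)`: `1/√((1-t²)(1-m t²)) ≤ (1-m)^{-1/2} (1-t)^{-1/2}` for `0 ≤ m < 1`. [folklore] -/
theorem ellIntegrand_le {m t : ℝ} (hm0 : 0 ≤ m) (hm : m < 1) (ht : t ∈ Ico (0 : ℝ) 1) :
    ellIntegrand m t ≤ (1 - m) ^ (-(1 / 2 : ℝ)) * (1 - t) ^ (-(1 / 2 : ℝ)) := by
  have h1 : 0 < 1 - t := by linarith [ht.2]
  have h2 : 0 < 1 - m := by linarith
  have hle : (1 - m) * (1 - t) ≤ (1 - t ^ 2) * (1 - m * t ^ 2) := by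
    rw [mul_comm (1 - m)]
    refine mul_le_mul ?_ ?_ h2.le (by nlinarith [ht.1])
    · nlinarith [ht.1]
    · nlinarith [ht.1, ht.2, mul_le_mul_of_nonneg_left (show t ^ 2 ≤ 1 by nlinarith [ht.1, ht.2]) hm0]
  have hpos : 0 < (1 - m) * (1 - t) := mul_pos h2 h1
  calc ellIntegrand m t ≤ 1 / Real.sqrt ((1 - m) * (1 - t)) := by
        exact one_div_le_one_div_of_le (Real.sqrt_pos.2 hpos) (Real.sqrt_le_sqrt hle)
    _ = (1 - m) ^ (-(1 / 2 : ℝ)) * (1 - t) ^ (-(1 / 2 : ℝ)) := by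
        rw [Real.sqrt_eq_rpow, one_div, ← Real.rpow_neg hpos.le, Real.mul_rpow h2.le h1.le]

/-- `t ↦ C (1 - t)^{-1/2}` is integrable on `[0, 1]`. [folklore] -/
theorem intervalIntegrable_const_mul_one_sub_rpow (C : ℝ) :
    IntervalIntegrable (fun t : ℝ => C * (1 - t) ^ (-(1 / 2 : ℝ))) volume 0 1 := by
  have h := (intervalIntegral.intervalIntegrable_rpow' (a := 0) (b := 1) (r := -(1 / 2 : ℝ))
    (by norm_num)).comp_sub_left 1
  simp only [sub_zero, sub_self] at h
  exact h.symm.const_mul C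

/-- **Integrability of the elliptic integrand on `[0, 1]`** for `0 ≤ m < 1` (integrable singularity
`(1-t)^{-1/2}` at `t = 1`). [folklore] -/
theorem intervalIntegrable_ellIntegrand {m : ℝ} (hm0 : 0 ≤ m) (hm : m < 1) :
    IntervalIntegrable (ellIntegrand m) volume 0 1 := by
  refine (intervalIntegrable_const_mul_one_sub_rpow ((1 - m) ^ (-(1 / 2 : ℝ)))).mono_fun'
    (measurable_ellIntegrand m).aestronglyMeasurable ?_
  rw [uIoc_of_le zero_le_one]
  refine (ae_restrict_iff' measurableSet_Ioc).2 (Eventually.of_forall fun t ht => ?_)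
  show ‖ellIntegrand m t‖ ≤ (1 - m) ^ (-(1 / 2 : ℝ)) * (1 - t) ^ (-(1 / 2 : ℝ))
  rw [Real.norm_of_nonneg (ellIntegrand_nonneg m t)]
  rcases eq_or_lt_of_le ht.2 with rfl | h1
  · simp [ellIntegrand]
  · exact ellIntegrand_le hm0 hm ⟨ht.1.le, h1⟩

/-- Integrability on `[-1, 0]` (the integrand is even). [folklore] -/
theorem intervalIntegrable_ellIntegrand_neg {m : ℝ} (hm0 : 0 ≤ m) (hm : m < 1) :
    IntervalIntegrable (ellIntegrand m) volume (-1) 0 := by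
  have h := (intervalIntegrable_ellIntegrand hm0 hm).comp_mul_left (c := -1)
  simp only [neg_mul, one_mul, ellIntegrand_neg, div_neg, div_one, neg_zero] at h
  exact h.symm

/-- **Integrability of the elliptic integrand on `[-1, 1]`** for `0 ≤ m < 1`. [folklore] -/
theorem intervalIntegrable_ellIntegrand_symm {m : ℝ} (hm0 : 0 ≤ m) (hm : m < 1) :
    IntervalIntegrable (ellIntegrand m) volume (-1) 1 :=
  (intervalIntegrable_ellIntegrand_neg hm0 hm).trans (intervalIntegrable_ellIntegrand hm0 hm)

/-- Integrability between any two points of `[-1, 1]`. [folklore] -/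
theorem intervalIntegrable_ellIntegrand_of_mem {m : ℝ} (hm0 : 0 ≤ m) (hm : m < 1) {a b : ℝ}
    (ha : a ∈ Icc (-1 : ℝ) 1) (hb : b ∈ Icc (-1 : ℝ) 1) :
    IntervalIntegrable (ellIntegrand m) volume a b :=
  (intervalIntegrable_ellIntegrand_symm hm0 hm).mono_set (by
    rw [uIcc_of_le (by norm_num : (-1 : ℝ) ≤ 1)]
    exact uIcc_subset_Icc ha hb)

/-- **`K(m) > 0`** for `0 ≤ m < 1`. [folklore] -/
theorem ellipticK_pos {m : ℝ} (hm0 : 0 ≤ m) (hm : m < 1) : 0 < ellipticK m :=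
  intervalIntegral.intervalIntegral_pos_of_pos_on (intervalIntegrable_ellIntegrand hm0 hm)
    (fun t ht => ellIntegrand_pos hm ⟨by linarith [ht.1], ht.2⟩) zero_lt_one

/-! ### The incomplete integral on `[-1, 1]` -/

/-- `F(m; ·)` is odd. [folklore] -/
theorem ellipticF_neg (m x : ℝ) : ellipticF m (-x) = -ellipticF m x := by
  unfold ellipticF
  have h : ∫ t in (0 : ℝ)..-x, ellIntegrand m t = ∫ t in (0 : ℝ)..-x, ellIntegrand m (-t) := by
    simp only [ellIntegrand_neg]
  rw [h, intervalIntegral.integral_comp_neg, neg_neg, neg_zero, intervalIntegral.integral_symm]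

/-- Additivity: `F(m; b) - F(m; a) = ∫ₐᵇ ellIntegrand m` for `a, b ∈ [-1, 1]`. [folklore] -/
theorem ellipticF_sub_ellipticF {m : ℝ} (hm0 : 0 ≤ m) (hm : m < 1) {a b : ℝ}
    (ha : a ∈ Icc (-1 : ℝ) 1) (hb : b ∈ Icc (-1 : ℝ) 1) :
    ellipticF m b - ellipticF m a = ∫ t in a..b, ellIntegrand m t := by
  unfold ellipticF
  have h0 : (0 : ℝ) ∈ Icc (-1 : ℝ) 1 := ⟨by norm_num, by norm_num⟩
  rw [intervalIntegral.integral_interval_sub_left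
    (intervalIntegrable_ellIntegrand_of_mem hm0 hm h0 hb)
    (intervalIntegrable_ellIntegrand_of_mem hm0 hm h0 ha)]

/-- **`F(m; ·)` is strictly increasing on `[-1, 1]`** (`0 ≤ m < 1`). [folklore] -/
theorem strictMonoOn_ellipticF {m : ℝ} (hm0 : 0 ≤ m) (hm : m < 1) :
    StrictMonoOn (ellipticF m) (Icc (-1 : ℝ) 1) := by
  intro a ha b hb hab
  have h := ellipticF_sub_ellipticF hm0 hm ha hb
  have hpos : 0 < ∫ t in a..b, ellIntegrand m t :=
    intervalIntegral.intervalIntegral_pos_of_pos_on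
      (intervalIntegrable_ellIntegrand_of_mem hm0 hm ha hb)
      (fun t ht => ellIntegrand_pos hm ⟨by linarith [ha.1, ht.1], by linarith [hb.2, ht.2]⟩) hab
  linarith

/-- **`F(m; ·)` is continuous on `[-1, 1]`** (`0 ≤ m < 1`). [folklore] -/
theorem continuousOn_ellipticF {m : ℝ} (hm0 : 0 ≤ m) (hm : m < 1) :
    ContinuousOn (ellipticF m) (Icc (-1 : ℝ) 1) := by
  have h := intervalIntegrable_ellIntegrand_symm hm0 hm
  have hle : (-1 : ℝ) ≤ 1 := by norm_num
  have := intervalIntegral.continuousOn_primitive_interval' h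
    (show (0 : ℝ) ∈ uIcc (-1 : ℝ) 1 by rw [uIcc_of_le hle]; exact ⟨by norm_num, by norm_num⟩)
  rw [uIcc_of_le hle] at this
  exact this

/-- Values of `F(m; ·)` on `[-1, 1]` lie in `[-K(m), K(m)]`. [folklore] -/
theorem ellipticF_mem_Icc {m : ℝ} (hm0 : 0 ≤ m) (hm : m < 1) {x : ℝ} (hx : x ∈ Icc (-1 : ℝ) 1) :
    ellipticF m x ∈ Icc (-ellipticK m) (ellipticK m) := by
  have hmono := (strictMonoOn_ellipticF hm0 hm).monotoneOn
  have h1 : (1 : ℝ) ∈ Icc (-1 : ℝ) 1 := ⟨by norm_num, le_rfl⟩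
  have hm1 : (-1 : ℝ) ∈ Icc (-1 : ℝ) 1 := ⟨le_rfl, by norm_num⟩
  refine ⟨?_, ?_⟩
  · have := hmono hm1 hx hx.1
    rwa [ellipticF_neg, ellipticF_one] at this
  · have := hmono hx h1 hx.2
    rwa [ellipticF_one] at this

/-- `F(m; x) ∈ (-K(m), K(m))` for `x ∈ (-1, 1)`. [folklore] -/
theorem ellipticF_mem_Ioo {m : ℝ} (hm0 : 0 ≤ m) (hm : m < 1) {x : ℝ} (hx : x ∈ Ioo (-1 : ℝ) 1) :
    ellipticF m x ∈ Ioo (-ellipticK m) (ellipticK m) := by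
  have hmono := strictMonoOn_ellipticF hm0 hm
  have h1 : (1 : ℝ) ∈ Icc (-1 : ℝ) 1 := ⟨by norm_num, le_rfl⟩
  have hm1 : (-1 : ℝ) ∈ Icc (-1 : ℝ) 1 := ⟨le_rfl, by norm_num⟩
  have hx' : x ∈ Icc (-1 : ℝ) 1 := ⟨hx.1.le, hx.2.le⟩
  refine ⟨?_, ?_⟩
  · have := hmono hm1 hx' hx.1
    rwa [ellipticF_neg, ellipticF_one] at this
  · have := hmono hx' h1 hx.2
    rwa [ellipticF_one] at this

/-! ### The imaginary-axis integral: `∫₀^∞ dy/√((1+y²)(1+k²y²)) = K(1-k²)` -/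

/-- The integrand `φ_k(y) = 1/√((1+y²)(1+k²y²))` of the Schwarz–Christoffel rectangle map along the
imaginary axis. [cite: BollobasRiordan2006, Ch. 7 §7.1 p. 185] -/
def imagAxisIntegrand (k y : ℝ) : ℝ := 1 / Real.sqrt ((1 + y ^ 2) * (1 + k ^ 2 * y ^ 2))

/-- `φ_k > 0`. [folklore] -/
theorem imagAxisIntegrand_pos (k y : ℝ) : 0 < imagAxisIntegrand k y :=
  one_div_pos.2 (Real.sqrt_pos.2 (by positivity))

/-- `φ_k` is continuous. [folklore] -/
theorem continuous_imagAxisIntegrand (k : ℝ) : Continuous (imagAxisIntegrand k) := by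
  refine continuous_const.div (by fun_prop) fun y => ?_
  exact (Real.sqrt_pos.2 (by positivity)).ne'

/-- `φ_k(y) ≤ (1 + k²y²)⁻¹`. [folklore] -/
theorem imagAxisIntegrand_le {k : ℝ} (hk : k ^ 2 ≤ 1) (y : ℝ) :
    imagAxisIntegrand k y ≤ (1 + k ^ 2 * y ^ 2)⁻¹ := by
  have h1 : 0 < 1 + k ^ 2 * y ^ 2 := by positivity
  have hle : (1 + k ^ 2 * y ^ 2) ^ 2 ≤ (1 + y ^ 2) * (1 + k ^ 2 * y ^ 2) := by
    rw [sq]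
    exact mul_le_mul_of_nonneg_right (by nlinarith [sq_nonneg y]) h1.le
  calc imagAxisIntegrand k y ≤ 1 / Real.sqrt ((1 + k ^ 2 * y ^ 2) ^ 2) :=
        one_div_le_one_div_of_le (Real.sqrt_pos.2 (by positivity)) (Real.sqrt_le_sqrt hle)
    _ = (1 + k ^ 2 * y ^ 2)⁻¹ := by rw [Real.sqrt_sq h1.le, one_div]

/-- `φ_k` is integrable on `(0, ∞)` for `0 < k ≤ 1`. [folklore] -/
theorem integrableOn_imagAxisIntegrand {k : ℝ} (hk0 : 0 < k) (hk : k ≤ 1) :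
    IntegrableOn (imagAxisIntegrand k) (Ioi 0) volume := by
  have hk2 : k ^ 2 ≤ 1 := by nlinarith
  have hint : Integrable (fun y : ℝ => (1 + k ^ 2 * y ^ 2)⁻¹) volume := by
    have h := integrable_inv_one_add_sq.comp_mul_left' (ne_of_gt hk0)
    refine h.congr (Eventually.of_forall fun y => ?_)
    show (1 + (k * y) ^ 2)⁻¹ = (1 + k ^ 2 * y ^ 2)⁻¹
    rw [mul_pow]
  refine (hint.integrableOn.mono_set (subset_univ _)).mono' ?_ ?_
  · exact (continuous_imagAxisIntegrand k).aestronglyMeasurable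
  · refine Eventually.of_forall fun y => ?_
    rw [Real.norm_of_nonneg (imagAxisIntegrand_pos k y).le]
    exact imagAxisIntegrand_le hk2 y

/-- The substitution map `y ↦ y/√(1+y²)` (a bijection `(0, ∞) → (0, 1)`, inverse `t ↦ t/√(1-t²)`). [folklore] -/
def sinAtan (y : ℝ) : ℝ := y / Real.sqrt (1 + y ^ 2)

/-- Its derivative `(1+y²)^{-3/2} = 1/(√(1+y²)(1+y²))`. [folklore] -/
def sinAtanDeriv (y : ℝ) : ℝ := 1 / (Real.sqrt (1 + y ^ 2) * (1 + y ^ 2))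

/-- `d/dy (y/√(1+y²)) = (1+y²)^{-3/2}`. [folklore] -/
theorem hasDerivAt_sinAtan (y : ℝ) : HasDerivAt sinAtan (sinAtanDeriv y) y := by
  have h1 : 0 < 1 + y ^ 2 := by positivity
  set s := Real.sqrt (1 + y ^ 2) with hs_def
  have hs : 0 < s := Real.sqrt_pos.2 h1
  have hsq : s ^ 2 = 1 + y ^ 2 := Real.sq_sqrt h1.le
  have hin : HasDerivAt (fun y : ℝ => 1 + y ^ 2) (2 * y) y := by
    simpa using (hasDerivAt_pow 2 y).const_add 1
  have hsqrt : HasDerivAt (fun y : ℝ => Real.sqrt (1 + y ^ 2)) (2 * y / (2 * s)) y :=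
    hin.sqrt h1.ne'
  have h := (hasDerivAt_id' y).div hsqrt hs.ne'
  have hval : (1 * s - y * (2 * y / (2 * s))) / s ^ 2 = sinAtanDeriv y := by
    have hs0 : s ≠ 0 := hs.ne'
    have hy2 : y ^ 2 = s ^ 2 - 1 := by linarith
    have hnum : y * (2 * y / (2 * s)) = (s ^ 2 - 1) / s := by
      rw [← hy2]; field_simp
    unfold sinAtanDeriv
    rw [← hs_def, ← hsq, hnum]
    field_simp
    ring
  exact hval ▸ h

/-- `0 < y/√(1+y²) < 1` for `y > 0`. [folklore] -/
theorem sinAtan_mem_Ioo {y : ℝ} (hy : 0 < y) : sinAtan y ∈ Ioo (0 : ℝ) 1 := by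
  have h1 : 0 < 1 + y ^ 2 := by positivity
  have hs : 0 < Real.sqrt (1 + y ^ 2) := Real.sqrt_pos.2 h1
  refine ⟨div_pos hy hs, (div_lt_one hs).2 ?_⟩
  rw [Real.lt_sqrt hy.le]
  nlinarith

/-- `(y/√(1+y²))² = y²/(1+y²)`. [folklore] -/
theorem sinAtan_sq (y : ℝ) : sinAtan y ^ 2 = y ^ 2 / (1 + y ^ 2) := by
  rw [sinAtan, div_pow, Real.sq_sqrt (by positivity)]

/-- `y ↦ y/√(1+y²)` is injective on `(0, ∞)`. [folklore] -/
theorem injOn_sinAtan : InjOn sinAtan (Ioi (0 : ℝ)) := by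
  intro a ha b hb h
  have ha' : (0 : ℝ) < a := ha
  have hb' : (0 : ℝ) < b := hb
  have h2 : sinAtan a ^ 2 = sinAtan b ^ 2 := by rw [h]
  rw [sinAtan_sq, sinAtan_sq] at h2
  have h1a : 0 < 1 + a ^ 2 := by positivity
  have h1b : 0 < 1 + b ^ 2 := by positivity
  rw [div_eq_div_iff h1a.ne' h1b.ne'] at h2
  have hsq : a ^ 2 = b ^ 2 := by nlinarith
  have := (sq_eq_sq₀ ha'.le hb'.le).1 hsq
  exact this

/-- The image of `(0, ∞)` under `y ↦ y/√(1+y²)` is `(0, 1)`. [folklore] -/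
theorem image_sinAtan_Ioi : sinAtan '' Ioi (0 : ℝ) = Ioo 0 1 := by
  refine Subset.antisymm ?_ ?_
  · rintro _ ⟨y, hy, rfl⟩
    exact sinAtan_mem_Ioo hy
  · intro t ht
    have h1 : 0 < 1 - t ^ 2 := by nlinarith [ht.1, ht.2]
    have hs : 0 < Real.sqrt (1 - t ^ 2) := Real.sqrt_pos.2 h1
    refine ⟨t / Real.sqrt (1 - t ^ 2), div_pos ht.1 hs, ?_⟩
    have hy2 : 1 + (t / Real.sqrt (1 - t ^ 2)) ^ 2 = 1 / (1 - t ^ 2) := by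
      rw [div_pow, Real.sq_sqrt h1.le]
      field_simp
      ring
    rw [sinAtan, hy2, Real.sqrt_div' _ h1.le, Real.sqrt_one, div_div_eq_mul_div, div_one,
      div_mul_cancel₀ _ hs.ne']

/-- **Pull-back of the elliptic integrand.** With `t = y/√(1+y²)`:
`ellIntegrand (1-k²) t · dt/dy = 1/√((1+y²)(1+k²y²))`. [folklore] -/
theorem ellIntegrand_sinAtan_mul (k y : ℝ) :
    ellIntegrand (1 - k ^ 2) (sinAtan y) * sinAtanDeriv y = imagAxisIntegrand k y := by
  have h1 : 0 < 1 + y ^ 2 := by positivity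
  have hs : 0 < Real.sqrt (1 + y ^ 2) := Real.sqrt_pos.2 h1
  have h2 : 0 < 1 + k ^ 2 * y ^ 2 := by positivity
  have hrad : (1 - sinAtan y ^ 2) * (1 - (1 - k ^ 2) * sinAtan y ^ 2) =
      (1 + k ^ 2 * y ^ 2) / (1 + y ^ 2) ^ 2 := by
    rw [sinAtan_sq]
    field_simp
    ring
  rw [ellIntegrand, hrad, sinAtanDeriv, imagAxisIntegrand, Real.sqrt_div' _ (by positivity),
    Real.sqrt_sq h1.le, Real.sqrt_mul h1.le]
  field_simp

/-- **The imaginary-axis integral is a complete elliptic integral**: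
`∫₀^∞ dy/√((1+y²)(1+k²y²)) = K(1 - k²)` (for every real `k`; used for `0 < k < 1`) (parameter convention; `= K(k′)`, `k′ = √(1-k²)`, in
modulus notation). Substitution `t = y/√(1+y²)`. Whittaker–Watson §22.32; Ahlfors (1979),
Ch. 6 §2.3. [cite: AhlforsCA1979, Ch. 6 §2.3] -/
theorem integral_Ioi_imagAxisIntegrand_eq_ellipticK (k : ℝ) :
    ∫ y in Ioi (0 : ℝ), imagAxisIntegrand k y = ellipticK (1 - k ^ 2) := by
  have himg := integral_image_eq_integral_abs_deriv_smul (s := Ioi (0 : ℝ)) (f := sinAtan)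
    (f' := sinAtanDeriv) measurableSet_Ioi (fun y _ => (hasDerivAt_sinAtan y).hasDerivWithinAt)
    injOn_sinAtan (ellIntegrand (1 - k ^ 2))
  rw [image_sinAtan_Ioi] at himg
  have hφ : ∀ y : ℝ, |sinAtanDeriv y| • ellIntegrand (1 - k ^ 2) (sinAtan y) = imagAxisIntegrand k y := by
    intro y
    have hpos : 0 < sinAtanDeriv y := one_div_pos.2 (by positivity)
    rw [abs_of_pos hpos, smul_eq_mul, mul_comm, ellIntegrand_sinAtan_mul]
  simp only [hφ] at himg
  rw [← himg, ellipticK_eq, intervalIntegral.integral_of_le zero_le_one, integral_Ioc_eq_integral_Ioo]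

/-- The imaginary-axis integral is positive. [folklore] -/
theorem integral_Ioi_imagAxisIntegrand_pos {k : ℝ} (hk0 : 0 < k) (hk1 : k < 1) :
    0 < ∫ y in Ioi (0 : ℝ), imagAxisIntegrand k y := by
  rw [integral_Ioi_imagAxisIntegrand_eq_ellipticK k]
  exact ellipticK_pos (by nlinarith) (by nlinarith)

/-- The partial integrals `∫₀^Y φ_k` tend to `K(1 - k²)` as `Y → ∞`. [folklore] -/
theorem tendsto_integral_imagAxisIntegrand {k : ℝ} (hk0 : 0 < k) (hk1 : k < 1) :
    Tendsto (fun Y : ℝ => ∫ y in (0 : ℝ)..Y, imagAxisIntegrand k y) atTop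
      (𝓝 (ellipticK (1 - k ^ 2))) := by
  rw [← integral_Ioi_imagAxisIntegrand_eq_ellipticK k]
  exact intervalIntegral_tendsto_integral_Ioi 0 (integrableOn_imagAxisIntegrand hk0 hk1.le)
    tendsto_id

end Literature.Probability.RandomPlanarGeometry

end
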